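import Literature.Analysis.Complex.RungeParameters
import Literature.Analysis.Complex.LogOnePlus
import Mathlib.Analysis.Calculus.FDeriv.Mul
import HarnessLib

/-!
# Runge approximation for invertible holomorphic maps on convex sets (Grauert, Cartan)

Let `𝔄` be a complete normed `ℂ`-algebra with `‖1‖ = 1` (e.g. `r × r` matrices with an operator
norm), `K = R × K'` with `R = [a, b] × [c, d] ⊂ ℂ` a compact rectangle and `K' ⊂ P` a compact convex
set of parameters, and let `f` be holomorphic with **invertible values** on a convex open set
`U ⊇ Q × K'`, `Q ⊃ R` a bigger rectangle. Then `f` is, uniformly on `R × K'`, a limit of maps `g`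
holomorphic on `ℂ × V` (`V ⊇ K'` open) **with invertible values** (`runge_units_rectangle_param`).

This is the convex (hence topologically trivial) case of Grauert's Runge theorem for holomorphic
maps into a complex Lie group (Grauert, Math. Ann. 133 (1957) 139–159, Satz 2 for `GL(r, ℂ)`;
H. Cartan, J. Math. Pures Appl. 19 (1940), §3, for matrices near a product of exponentials), the
approximation ingredient of Cartan's theorem on holomorphic matrices and of the Oka–Grauert
principle.

## The argument

Fix `w₀ ∈ K` and `N ≫ 1`; with `w_k = w₀ + (k/N)(w − w₀)` (which stays in the convex sets `U`,
`Q × K'`) write the telescoping product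

  `f(w) = f(w₀) · u₀(w) ⋯ u_{N−1}(w)`,  `u_k(w) = f(w_k)⁻¹ f(w_{k+1})`,

where, by uniform continuity of `f` and boundedness of `f⁻¹` on the compact set `Q × K'`,
`‖u_k − 1‖ ≤ 1/4` there. Hence `u_k = exp h_k` with `h_k = log (1 + (u_k − 1))` holomorphic near
`Q × K'` (`Literature/Analysis/Complex/LogOnePlus.lean`). Runge with parameters
(`exists_holomorphic_approx_rectangle_param`, GR Kap. III §2 Satz 1) gives `ĥ_k` holomorphic on
`ℂ × V_k` close to `h_k` on `R × K'`, and `g = f(w₀) · exp ĥ₀ ⋯ exp ĥ_{N−1}` is holomorphic on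
`ℂ × ⋂ V_k` with invertible values; `‖f − g‖` is small by the Lipschitz estimate
`‖exp x − exp y‖ ≤ ‖x − y‖ e^{max(‖x‖,‖y‖)}` and the perturbation estimate for ordered products.

## References

* H. Grauert, *Approximationssätze für holomorphe Funktionen mit Werten in komplexen Räumen*,
  Math. Ann. 133 (1957) 139–159, §2 [Grauert1957].
* H. Cartan, *Sur les matrices holomorphes de `n` variables complexes*, J. Math. Pures Appl. 19
  (1940) 1–26, §3 [Cartan1940].
* H. Grauert, R. Remmert, *Theorie der Steinschen Räume* (1977), Kap. III §2 [GrauertRemmert1977].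
-/

noncomputable section

open Complex Set Filter Topology Metric NormedSpace
open scoped Nat

namespace Literature.Analysis.Complex

/-! ### Elementary estimates in a Banach algebra: powers, `exp`, ordered products -/

section Estimates

variable {𝔄 : Type*} [NormedRing 𝔄] [NormedAlgebra ℂ 𝔄] [CompleteSpace 𝔄] [NormOneClass 𝔄]

omit [NormedAlgebra ℂ 𝔄] [CompleteSpace 𝔄] in
/-- `‖x^{n+1} − y^{n+1}‖ ≤ (n + 1) max(‖x‖, ‖y‖)ⁿ ‖x − y‖` (telescoping, no commutativity needed).
[folklore] -/
theorem norm_pow_succ_sub_pow_succ_le (x y : 𝔄) (n : ℕ) :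
    ‖x ^ (n + 1) - y ^ (n + 1)‖ ≤ (n + 1) * max ‖x‖ ‖y‖ ^ n * ‖x - y‖ := by
  set M := max ‖x‖ ‖y‖ with hM
  have hxM : ‖x‖ ≤ M := le_max_left _ _
  have hyM : ‖y‖ ≤ M := le_max_right _ _
  have hM0 : 0 ≤ M := (norm_nonneg x).trans hxM
  induction n with
  | zero => simp
  | succ n ih =>
    have hid : x ^ (n + 2) - y ^ (n + 2) = x * (x ^ (n + 1) - y ^ (n + 1)) + (x - y) * y ^ (n + 1) := by
      rw [mul_sub, sub_mul, pow_succ' x (n + 1), pow_succ' y (n + 1)]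
      abel
    rw [hid]
    refine (norm_add_le _ _).trans ?_
    have h1 : ‖x * (x ^ (n + 1) - y ^ (n + 1))‖ ≤ M * ((n + 1) * M ^ n * ‖x - y‖) :=
      (norm_mul_le _ _).trans (mul_le_mul hxM ih (norm_nonneg _) hM0)
    have h2 : ‖(x - y) * y ^ (n + 1)‖ ≤ ‖x - y‖ * M ^ (n + 1) :=
      (norm_mul_le _ _).trans (mul_le_mul_of_nonneg_left
        ((norm_pow_le y (n + 1)).trans (pow_le_pow_left₀ (norm_nonneg _) hyM _)) (norm_nonneg _))
    calc ‖x * (x ^ (n + 1) - y ^ (n + 1))‖ + ‖(x - y) * y ^ (n + 1)‖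
        ≤ M * ((n + 1) * M ^ n * ‖x - y‖) + ‖x - y‖ * M ^ (n + 1) := add_le_add h1 h2
      _ = (↑(n + 1) + 1) * M ^ (n + 1) * ‖x - y‖ := by push_cast; ring

/-- `‖exp x‖ ≤ e^{‖x‖}` (here `‖1‖ = 1` is used for the constant term). [folklore] -/
theorem norm_exp_le_exp_norm (x : 𝔄) : ‖exp x‖ ≤ Real.exp ‖x‖ := by
  have hx := exp_series_hasSum_exp' (𝕂 := ℂ) x
  rw [← hx.tsum_eq]
  have hreal : HasSum (fun n : ℕ => ‖x‖ ^ n / n !) (Real.exp ‖x‖) := by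
    have h := exp_series_hasSum_exp' (𝕂 := ℝ) ‖x‖
    rw [← Real.exp_eq_exp_ℝ] at h
    simpa [smul_eq_mul, div_eq_inv_mul] using h
  refine tsum_of_norm_bounded hreal fun n => ?_
  rw [norm_smul, norm_inv, Complex.norm_natCast, div_eq_inv_mul]
  rcases Nat.eq_zero_or_pos n with rfl | hn
  · simp
  · exact mul_le_mul_of_nonneg_left (norm_pow_le' x hn) (by positivity)

/-- **`exp` is locally Lipschitz**: `‖exp x − exp y‖ ≤ ‖x − y‖ · e^{max(‖x‖, ‖y‖)}` in any Banach
algebra (term-wise from `‖xⁿ − yⁿ‖ ≤ n Mⁿ⁻¹ ‖x − y‖`). [folklore] -/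
theorem norm_exp_sub_exp_le (x y : 𝔄) :
    ‖exp x - exp y‖ ≤ ‖x - y‖ * Real.exp (max ‖x‖ ‖y‖) := by
  nontriviality 𝔄
  set M := max ‖x‖ ‖y‖ with hM
  have hsub := (exp_series_hasSum_exp' (𝕂 := ℂ) x).sub (exp_series_hasSum_exp' (𝕂 := ℂ) y)
  rw [← hsub.tsum_eq]
  -- the dominating real series `b 0 = 0`, `b (n+1) = Mⁿ/n! · ‖x − y‖`, with sum `e^M ‖x − y‖`
  set b : ℕ → ℝ := fun n => Nat.casesOn n 0 fun m => M ^ m / m ! * ‖x - y‖ with hb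
  have hreal : HasSum (fun n : ℕ => M ^ n / n !) (Real.exp M) := by
    have h := exp_series_hasSum_exp' (𝕂 := ℝ) M
    rw [← Real.exp_eq_exp_ℝ] at h
    simpa [smul_eq_mul, div_eq_inv_mul] using h
  have hbsum : HasSum b (‖x - y‖ * Real.exp M) := by
    have h1 : HasSum (fun n : ℕ => b (n + 1)) (Real.exp M * ‖x - y‖) := by
      simpa [hb] using hreal.mul_right ‖x - y‖
    rw [mul_comm]
    refine (hasSum_nat_add_iff' 1).1 ?_
    simpa [hb] using h1
  refine tsum_of_norm_bounded hbsum fun n => ?_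
  cases n with
  | zero => simp [hb]
  | succ m =>
    simp only [hb]
    rw [← smul_sub, norm_smul, norm_inv, Complex.norm_natCast]
    have hfac : ((m + 1)! : ℝ) = (m + 1) * m ! := by push_cast [Nat.factorial_succ]; ring
    have hm0 : (0 : ℝ) < m ! := by positivity
    calc ((m + 1)! : ℝ)⁻¹ * ‖x ^ (m + 1) - y ^ (m + 1)‖
        ≤ ((m + 1)! : ℝ)⁻¹ * ((m + 1) * M ^ m * ‖x - y‖) :=
          mul_le_mul_of_nonneg_left (norm_pow_succ_sub_pow_succ_le x y m) (by positivity)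
      _ = M ^ m / m ! * ‖x - y‖ := by
          rw [hfac]; field_simp

omit [NormedAlgebra ℂ 𝔄] [CompleteSpace 𝔄] in
/-- Norm of an ordered product with factors of norm `≤ B`. [folklore] -/
theorem norm_list_map_prod_le_pow {ι : Type*} (l : List ι) (x : ι → 𝔄) {B : ℝ}
    (hx : ∀ i ∈ l, ‖x i‖ ≤ B) : ‖(l.map x).prod‖ ≤ B ^ l.length := by
  induction l with
  | nil => simp
  | cons i l ih =>
    simp only [List.map_cons, List.prod_cons, List.length_cons, pow_succ']
    have hB : 0 ≤ B := (norm_nonneg _).trans (hx i (List.mem_cons_self ..))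
    exact (norm_mul_le _ _).trans (mul_le_mul (hx i (List.mem_cons_self ..))
      (ih fun j hj => hx j (List.mem_cons_of_mem _ hj)) (norm_nonneg _) hB)

omit [NormedAlgebra ℂ 𝔄] [CompleteSpace 𝔄] in
/-- **Perturbation of ordered products**: if all factors have norm `≤ B` (`B ≥ 1`) and corresponding
factors differ by `≤ ε`, the ordered products differ by `≤ n Bⁿ ε`. [folklore] -/
theorem norm_list_prod_sub_list_prod_le {ι : Type*} (l : List ι) (x y : ι → 𝔄) {B ε : ℝ}
    (hB : 1 ≤ B) (hε : 0 ≤ ε) (hx : ∀ i ∈ l, ‖x i‖ ≤ B) (hy : ∀ i ∈ l, ‖y i‖ ≤ B)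
    (hxy : ∀ i ∈ l, ‖x i - y i‖ ≤ ε) :
    ‖(l.map x).prod - (l.map y).prod‖ ≤ l.length * B ^ l.length * ε := by
  induction l with
  | nil => simp
  | cons i l ih =>
    simp only [List.map_cons, List.prod_cons, List.length_cons]
    have hxi := hx i (List.mem_cons_self ..)
    have hyi := hy i (List.mem_cons_self ..)
    have hxyi := hxy i (List.mem_cons_self ..)
    have ih' := ih (fun j hj => hx j (List.mem_cons_of_mem _ hj))
      (fun j hj => hy j (List.mem_cons_of_mem _ hj)) (fun j hj => hxy j (List.mem_cons_of_mem _ hj))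
    have hX := norm_list_map_prod_le_pow l x (fun j hj => hx j (List.mem_cons_of_mem _ hj))
    have hB0 : 0 ≤ B := zero_le_one.trans hB
    set n := l.length
    have hid : x i * (l.map x).prod - y i * (l.map y).prod =
        (x i - y i) * (l.map x).prod + y i * ((l.map x).prod - (l.map y).prod) := by
      rw [sub_mul, mul_sub]; abel
    rw [hid]
    refine (norm_add_le _ _).trans ?_
    have h1 : ‖(x i - y i) * (l.map x).prod‖ ≤ ε * B ^ n :=
      (norm_mul_le _ _).trans (mul_le_mul hxyi hX (norm_nonneg _) hε)
    have h2 : ‖y i * ((l.map x).prod - (l.map y).prod)‖ ≤ B * (n * B ^ n * ε) :=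
      (norm_mul_le _ _).trans (mul_le_mul hyi ih' (norm_nonneg _) hB0)
    have hBn : B ^ n ≤ B ^ (n + 1) := pow_le_pow_right₀ hB n.le_succ
    calc ‖(x i - y i) * (l.map x).prod‖ + ‖y i * ((l.map x).prod - (l.map y).prod)‖
        ≤ ε * B ^ n + B * (n * B ^ n * ε) := add_le_add h1 h2
      _ ≤ ε * B ^ (n + 1) + B * (n * B ^ n * ε) := by gcongr
      _ = (↑(n + 1) : ℝ) * B ^ (n + 1) * ε := by push_cast; ring

omit [CompleteSpace 𝔄] [NormOneClass 𝔄] in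
/-- Ordered products of holomorphic maps are holomorphic. [folklore] -/
theorem differentiableOn_list_map_prod {E : Type*} [NormedAddCommGroup E] [NormedSpace ℂ E]
    {ι : Type*} (l : List ι) {F : ι → E → 𝔄} {s : Set E}
    (h : ∀ i ∈ l, DifferentiableOn ℂ (F i) s) :
    DifferentiableOn ℂ (fun w => (l.map fun i => F i w).prod) s := by
  induction l with
  | nil => simp only [List.map_nil, List.prod_nil]; exact differentiableOn_const _
  | cons i l ih =>
    simp only [List.map_cons, List.prod_cons]
    exact (h i (List.mem_cons_self ..)).mul (ih fun j hj => h j (List.mem_cons_of_mem _ hj))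

end Estimates

/-! ### Runge for maps with invertible values, convex case -/

section Main

variable {P : Type*} [NormedAddCommGroup P] [NormedSpace ℂ P]
  {𝔄 : Type*} [NormedRing 𝔄] [NormedAlgebra ℂ 𝔄] [CompleteSpace 𝔄] [NormOneClass 𝔄]

/-- **Runge approximation for holomorphic maps with invertible values, convex case** (Grauert 1957,
§2; Cartan 1940, §3). Let `𝔄` be a complete normed `ℂ`-algebra with `‖1‖ = 1`, `U ⊆ ℂ × P` a convex
open set, `f : U → 𝔄ˣ` holomorphic (i.e. holomorphic with invertible values), `K' ⊆ P` compact
convex and `[a − η, b + η] × [c − η, d + η] × K' ⊆ U`. Then for every `δ > 0` there are an open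
`V ⊇ K'` and `g` holomorphic on `ℂ × V` with invertible values such that `‖f − g‖ ≤ δ` on
`([a, b] × [c, d]) × K'`. [cite: Grauert1957, §2 Satz 2 (convex case)] -/
theorem runge_units_rectangle_param {f : ℂ × P → 𝔄} {U : Set (ℂ × P)} (hU : IsOpen U)
    (hUc : Convex ℝ U) (hf : DifferentiableOn ℂ f U) (hunit : ∀ w ∈ U, IsUnit (f w))
    {a b c d η : ℝ} (hab : a ≤ b) (hcd : c ≤ d) (hη : 0 < η)
    {K' : Set P} (hK' : IsCompact K') (hK'c : Convex ℝ K')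
    (hsub : (Icc (a - η) (b + η) ×ℂ Icc (c - η) (d + η)) ×ˢ K' ⊆ U) {δ : ℝ} (hδ : 0 < δ) :
    ∃ (g : ℂ × P → 𝔄) (V : Set P), IsOpen V ∧ K' ⊆ V ∧ DifferentiableOn ℂ g (univ ×ˢ V) ∧
      (∀ w ∈ univ ×ˢ V, IsUnit (g w)) ∧
      ∀ z ∈ Icc a b ×ℂ Icc c d, ∀ p ∈ K', ‖f (z, p) - g (z, p)‖ ≤ δ := by
  -- the degenerate case `K' = ∅`
  rcases K'.eq_empty_or_nonempty with hK'e | ⟨p₀, hp₀⟩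
  · refine ⟨fun _ => 1, univ, isOpen_univ, subset_univ _, differentiableOn_const _,
      fun w _ => isUnit_one, ?_⟩
    simp [hK'e]
  -- the compact convex set `C = Q × K'` and the base point `w₀`
  set Q : Set ℂ := Icc (a - η) (b + η) ×ℂ Icc (c - η) (d + η) with hQ
  set C : Set (ℂ × P) := Q ×ˢ K' with hC
  have hCU : C ⊆ U := hsub
  have hCc : IsCompact C := (isCompact_Icc.reProdIm isCompact_Icc).prod hK'
  have hQconv : Convex ℝ Q := by
    -- a closed rectangle is convex (cf. `Literature.Topology.PlaneTopology.convex_Icc_reProdIm_Icc`)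
    rw [hQ, ← (convex_Icc (𝕜 := ℝ) (a - η) (b + η)).convexHull_eq,
      ← (convex_Icc (𝕜 := ℝ) (c - η) (d + η)).convexHull_eq, ← Complex.convexHull_reProdIm]
    exact convex_convexHull ℝ _
  have hCconv : Convex ℝ C := hQconv.prod hK'c
  have hRQ : Icc a b ×ℂ Icc c d ⊆ Q := fun z hz =>
    ⟨⟨by linarith [hz.1.1], by linarith [hz.1.2]⟩, ⟨by linarith [hz.2.1], by linarith [hz.2.2]⟩⟩
  set w₀ : ℂ × P := ((a : ℂ) + c * I, p₀) with hw₀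
  have hre : ((a : ℂ) + c * I).re = a := by simp
  have him : ((a : ℂ) + c * I).im = c := by simp
  have hw₀C : w₀ ∈ C := by
    refine ⟨⟨?_, ?_⟩, hp₀⟩
    · show ((a : ℂ) + c * I).re ∈ Icc (a - η) (b + η)
      rw [hre]
      exact ⟨by linarith, by linarith⟩
    · show ((a : ℂ) + c * I).im ∈ Icc (c - η) (d + η)
      rw [him]
      exact ⟨by linarith, by linarith⟩
  have hw₀U : w₀ ∈ U := hCU hw₀C
  -- continuity of `f` and `f⁻¹`, bounds
  have hfC : ContinuousOn f U := hf.continuousOn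
  have hinvC : ContinuousOn (fun w => Ring.inverse (f w)) U := by
    intro w hw
    have h1 := NormedRing.inverse_continuousAt (hunit w hw).unit
    rw [IsUnit.unit_spec] at h1
    exact h1.comp_continuousWithinAt (hfC w hw)
  obtain ⟨B₀, hB₀⟩ := hCc.exists_bound_of_continuousOn (hinvC.mono hCU)
  set B : ℝ := max B₀ 1 with hBdef
  have hB1 : 1 ≤ B := le_max_right _ _
  have hB0 : 0 < B := one_pos.trans_le hB1
  have hB : ∀ w ∈ C, ‖Ring.inverse (f w)‖ ≤ B := fun w hw => (hB₀ w hw).trans (le_max_left _ _)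
  have huc := hCc.uniformContinuousOn_of_continuous (hfC.mono hCU)
  obtain ⟨θ, hθ0, hθ⟩ := Metric.uniformContinuousOn_iff.1 huc (1 / (4 * B)) (by positivity)
  obtain ⟨D₀, hD₀⟩ := hCc.isBounded.exists_norm_le
  set D : ℝ := D₀ + ‖w₀‖ with hDdef
  have hD : ∀ w ∈ C, ‖w - w₀‖ ≤ D := fun w hw =>
    (norm_sub_le _ _).trans (add_le_add (hD₀ w hw) le_rfl)
  have hD0 : 0 ≤ D := by simpa using hD w₀ hw₀C
  -- the number of steps
  obtain ⟨N, hNpos, hNθ⟩ : ∃ N : ℕ, 0 < N ∧ D / N < θ := by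
    refine ⟨⌈D / θ⌉₊ + 1, Nat.succ_pos _, ?_⟩
    have h1 : D / θ < (⌈D / θ⌉₊ + 1 : ℕ) := by
      push_cast
      exact (Nat.le_ceil _).trans_lt (lt_add_one _)
    have h2 : (0 : ℝ) < (⌈D / θ⌉₊ + 1 : ℕ) := by positivity
    rw [div_lt_iff₀ h2]
    rw [div_lt_iff₀ hθ0] at h1
    linarith [mul_comm θ ((⌈D / θ⌉₊ + 1 : ℕ) : ℝ)]
  have hN0 : (N : ℂ) ≠ 0 := Nat.cast_ne_zero.2 hNpos.ne'
  have hN0' : (0 : ℝ) < N := Nat.cast_pos.2 hNpos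
  -- the intermediate points `w_k = w₀ + (k/N)(w − w₀)`
  set pt : ℕ → ℂ × P → ℂ × P := fun k w => w₀ + ((k : ℂ) / N) • (w - w₀) with hpt
  have hpt_real : ∀ k w, pt k w = w₀ + ((k : ℝ) / N) • (w - w₀) := by
    intro k w
    simp only [hpt]
    rw [← Complex.coe_smul]
    push_cast
    rfl
  have hpt_mem : ∀ {s : Set (ℂ × P)}, Convex ℝ s → w₀ ∈ s → ∀ k ≤ N, ∀ w ∈ s, pt k w ∈ s := by
    intro s hs h0 k hk w hw
    rw [hpt_real]
    exact hs.add_smul_sub_mem h0 hw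
      ⟨by positivity, div_le_one_of_le₀ (by exact_mod_cast hk) hN0'.le⟩
  have hpt0 : ∀ w, pt 0 w = w₀ := fun w => by simp [hpt]
  have hptN : ∀ w, pt N w = w := fun w => by simp [hpt, div_self hN0]
  have hpt_diff : ∀ k, Differentiable ℂ (pt k) := fun k => by simp only [hpt]; fun_prop
  have hpt_dist : ∀ k, ∀ w ∈ C, dist (pt (k + 1) w) (pt k w) < θ := by
    intro k w hw
    have h1 : pt (k + 1) w - pt k w = ((N : ℂ)⁻¹) • (w - w₀) := by
      simp only [hpt]
      rw [add_sub_add_left_eq_sub, ← sub_smul]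
      congr 1
      push_cast
      field_simp
      ring
    rw [dist_eq_norm, h1, norm_smul, norm_inv, Complex.norm_natCast]
    calc (N : ℝ)⁻¹ * ‖w - w₀‖ ≤ (N : ℝ)⁻¹ * D := by gcongr; exact hD w hw
      _ = D / N := by rw [inv_mul_eq_div]
      _ < θ := hNθ
  -- the factors `u_k = f(w_k)⁻¹ f(w_{k+1})`
  set u : ℕ → ℂ × P → 𝔄 := fun k w => Ring.inverse (f (pt k w)) * f (pt (k + 1) w) with hu
  have hfpt_diff : ∀ k ≤ N, DifferentiableOn ℂ (fun w => f (pt k w)) U := fun k hk =>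
    hf.comp (hpt_diff k).differentiableOn fun w hw => hpt_mem hUc hw₀U k hk w hw
  have hu_diff : ∀ k < N, DifferentiableOn ℂ (u k) U := by
    intro k hk
    refine DifferentiableOn.mul ?_ (hfpt_diff (k + 1) hk)
    intro w hw
    have hwk : pt k w ∈ U := hpt_mem hUc hw₀U k hk.le w hw
    exact (differentiableAt_inverse (hunit _ hwk)).comp_differentiableWithinAt w
      (hfpt_diff k hk.le w hw)
  have hu_cont : ∀ k < N, ContinuousOn (u k) U := fun k hk => (hu_diff k hk).continuousOn
  -- telescoping: `f(w_n) = f(w₀) u₀ ⋯ u_{n-1}`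
  have htel : ∀ n ≤ N, ∀ w ∈ U,
      f (pt n w) = f w₀ * ((List.range n).map fun k => u k w).prod := by
    intro n hn w hw
    induction n with
    | zero => simp [hpt0]
    | succ n ih =>
      rw [List.range_succ, List.map_append, List.prod_append, List.map_singleton,
        List.prod_singleton, ← mul_assoc, ← ih (Nat.le_of_succ_le hn)]
      simp only [hu]
      rw [← mul_assoc, Ring.mul_inverse_cancel _
        (hunit _ (hpt_mem hUc hw₀U n (Nat.le_of_succ_le hn) w hw)), one_mul]
  have hf_eq : ∀ w ∈ U, f w = f w₀ * ((List.range N).map fun k => u k w).prod := fun w hw => by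
    rw [← htel N le_rfl w hw, hptN]
  -- `‖u_k − 1‖ ≤ 1/4` on `C`
  have hu_small : ∀ k < N, ∀ w ∈ C, ‖u k w - 1‖ ≤ 1 / 4 := by
    intro k hk w hw
    have hwk : pt k w ∈ C := hpt_mem hCconv hw₀C k hk.le w hw
    have hwk1 : pt (k + 1) w ∈ C := hpt_mem hCconv hw₀C (k + 1) hk w hw
    have hunitk : IsUnit (f (pt k w)) := hunit _ (hCU hwk)
    have hid : u k w - 1 = Ring.inverse (f (pt k w)) * (f (pt (k + 1) w) - f (pt k w)) := by
      simp only [hu]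
      rw [mul_sub, Ring.inverse_mul_cancel _ hunitk]
    rw [hid]
    have hfd : ‖f (pt (k + 1) w) - f (pt k w)‖ < 1 / (4 * B) := by
      rw [← dist_eq_norm]
      exact hθ _ hwk1 _ hwk (hpt_dist k w hw)
    calc ‖Ring.inverse (f (pt k w)) * (f (pt (k + 1) w) - f (pt k w))‖
        ≤ B * (1 / (4 * B)) :=
          (norm_mul_le _ _).trans (mul_le_mul (hB _ hwk) hfd.le (norm_nonneg _) hB0.le)
      _ = 1 / 4 := by field_simp
  -- the logarithms `h_k = log (1 + (u_k − 1))` on `U_k = {‖u_k − 1‖ < 1/2}`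
  set Uk : ℕ → Set (ℂ × P) := fun k => U ∩ u k ⁻¹' ball 1 (1 / 2) with hUk
  have hUk_open : ∀ k < N, IsOpen (Uk k) := fun k hk =>
    (hu_cont k hk).isOpen_inter_preimage hU isOpen_ball
  have hnorm_lt : ∀ k w, w ∈ Uk k → ‖u k w - 1‖ < 1 / 2 := fun k w hw => by
    have h2 := hw.2
    rwa [mem_preimage, mem_ball, dist_eq_norm] at h2
  have hCUk : ∀ k < N, C ⊆ Uk k := fun k hk w hw =>
    ⟨hCU hw, by
      rw [mem_preimage, mem_ball, dist_eq_norm]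
      linarith [hu_small k hk w hw]⟩
  set h : ℕ → ℂ × P → 𝔄 := fun k w => logOnePlus (u k w - 1) with hh
  have hh_diff : ∀ k < N, DifferentiableOn ℂ (h k) (Uk k) := fun k hk =>
    differentiableOn_logOnePlus_comp (((hu_diff k hk).mono inter_subset_left).sub_const 1)
      fun w hw => (hnorm_lt k w hw).trans (by norm_num)
  have hexp_h : ∀ k w, w ∈ Uk k → exp (h k w) = u k w := fun k w hw =>
    exp_logOnePlus_sub_one ((hnorm_lt k w hw).trans (by norm_num))
  have hh_norm : ∀ k < N, ∀ w ∈ C, ‖h k w‖ ≤ 1 / 2 := fun k hk w hw =>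
    (norm_logOnePlus_le_two_mul ((hu_small k hk w hw).trans (by norm_num))).trans
      (by linarith [hu_small k hk w hw])
  -- Runge with parameters for each `h_k`
  set E : ℝ := Real.exp 1 with hE
  have hE1 : 1 ≤ E := by have := Real.add_one_le_exp (1 : ℝ); rw [hE]; linarith
  set δ₁ : ℝ := min (1 / 2) (δ / ((‖f w₀‖ + 1) * (N * E ^ (N + 1)))) with hδ₁
  have hδ₁0 : 0 < δ₁ := by positivity
  have hδ₁half : δ₁ ≤ 1 / 2 := min_le_left _ _
  have happrox : ∀ k, k < N → ∃ (gk : ℂ × P → 𝔄) (Vk : Set P), IsOpen Vk ∧ K' ⊆ Vk ∧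
      DifferentiableOn ℂ gk (univ ×ˢ Vk) ∧
      ∀ z ∈ Icc a b ×ℂ Icc c d, ∀ p ∈ K', ‖h k (z, p) - gk (z, p)‖ ≤ δ₁ := fun k hk =>
    exists_holomorphic_approx_rectangle_param (hUk_open k hk) (hh_diff k hk) hab hcd hη hK'
      (hCUk k hk) hδ₁0
  choose! ĝ V hVo hKV hĝd hĝ using happrox
  -- the approximant `g = f(w₀) exp ĝ₀ ⋯ exp ĝ_{N-1}` on `ℂ × ⋂ V_k`
  set W : Set P := ⋂ k ∈ Finset.range N, V k with hW
  have hexpd : Differentiable ℂ (exp : 𝔄 → 𝔄) := fun x =>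
    (exp_analytic (𝕂 := ℂ) x).differentiableAt
  refine ⟨fun w => f w₀ * ((List.range N).map fun k => exp (ĝ k w)).prod, W,
    isOpen_biInter_finset fun k hk => hVo k (Finset.mem_range.1 hk),
    fun p hp => mem_iInter₂.2 fun k hk => hKV k (Finset.mem_range.1 hk) hp, ?_, ?_, ?_⟩
  · -- holomorphic on `ℂ × W`
    refine (differentiableOn_const _).mul (differentiableOn_list_map_prod _ fun k hk => ?_)
    have hk' := List.mem_range.1 hk
    refine hexpd.comp_differentiableOn ((hĝd k hk').mono ?_)
    exact prod_mono Subset.rfl (biInter_subset_of_mem (Finset.mem_range.2 hk'))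
  · -- invertible values
    intro w _
    refine (hunit w₀ hw₀U).mul (List.prod_isUnit fun m hm => ?_)
    obtain ⟨k, -, rfl⟩ := List.mem_map.1 hm
    exact isUnit_exp_of_mem_ball (mem_eball_expSeries_radius _)
  · -- the estimate on `R × K'`
    intro z hz p hp
    have hwC : (z, p) ∈ C := ⟨hRQ hz, hp⟩
    have hwU : (z, p) ∈ U := hCU hwC
    rw [hf_eq _ hwU, ← mul_sub]
    refine (norm_mul_le _ _).trans ?_
    have hfac_u : ∀ k ∈ List.range N, ‖u k (z, p)‖ ≤ E := by
      intro k hk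
      have hk' := List.mem_range.1 hk
      rw [← hexp_h k _ (hCUk k hk' hwC)]
      refine (norm_exp_le_exp_norm _).trans (Real.exp_le_exp.2 ?_)
      linarith [hh_norm k hk' _ hwC]
    have hĝ_norm : ∀ k < N, ‖ĝ k (z, p)‖ ≤ 1 := by
      intro k hk
      have h1 := hĝ k hk z hz p hp
      have h2 := hh_norm k hk _ hwC
      have : ‖ĝ k (z, p)‖ ≤ ‖h k (z, p)‖ + ‖h k (z, p) - ĝ k (z, p)‖ := by
        rw [← norm_neg (h k (z, p) - ĝ k (z, p))]
        exact (norm_le_insert' _ _).trans (by rw [neg_sub])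
      linarith
    have hfac_g : ∀ k ∈ List.range N, ‖exp (ĝ k (z, p))‖ ≤ E := by
      intro k hk
      exact (norm_exp_le_exp_norm _).trans (Real.exp_le_exp.2 (hĝ_norm k (List.mem_range.1 hk)))
    have hfac_diff : ∀ k ∈ List.range N, ‖u k (z, p) - exp (ĝ k (z, p))‖ ≤ δ₁ * E := by
      intro k hk
      have hk' := List.mem_range.1 hk
      rw [← hexp_h k _ (hCUk k hk' hwC)]
      refine (norm_exp_sub_exp_le _ _).trans ?_
      refine mul_le_mul (hĝ k hk' z hz p hp) (Real.exp_le_exp.2 ?_) (by positivity) hδ₁0.le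
      exact max_le (by linarith [hh_norm k hk' _ hwC]) (hĝ_norm k hk')
    have hprod := norm_list_prod_sub_list_prod_le (List.range N) (fun k => u k (z, p))
      (fun k => exp (ĝ k (z, p))) hE1 (by positivity) hfac_u hfac_g hfac_diff
    rw [List.length_range] at hprod
    calc ‖f w₀‖ * ‖((List.range N).map fun k => u k (z, p)).prod -
            ((List.range N).map fun k => exp (ĝ k (z, p))).prod‖
        ≤ ‖f w₀‖ * (N * E ^ N * (δ₁ * E)) := by gcongr
      _ = ‖f w₀‖ * (N * E ^ (N + 1)) * δ₁ := by ring
      _ ≤ (‖f w₀‖ + 1) * (N * E ^ (N + 1)) * (δ / ((‖f w₀‖ + 1) * (N * E ^ (N + 1)))) := by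
          gcongr
          · linarith
          · exact min_le_right _ _
      _ = δ := by field_simp

end Main

end Literature.Analysis.Complex
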